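/-
Copyright (c) 2026. All rights reserved.
Released under Apache 2.0 license as described in the file LICENSE.
-/
import Literature.Geometry.Kaehler.ComplexTorusQuaternionXSixKRYDegreeFormulaHurwitzForm
import HarnessLib

/-!
# The degree of the special cycles of `X₆` for `t ≡ 3 (mod 4)`: `deg Z(t)_ℚ = δ(d; 6)·H(t)` (`9 ∤ t`), and the
# reduction of every `t` to a Hurwitz class number

[tag: complex_torus] [tag: abelian_surface] [tag: quaternion_multiplication] [tag: complex_multiplication]
[tag: shimura_curve] [tag: special_cycles] [tag: class_number] [tag: modular_form]

Lane `lit-hodgefound`, seat p12, row g42-#4 — THEOREMS ONLY (no definition, no named fact, no instance). Row g42-#2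
(`…XSixKRYDegreeFormulaHurwitzForm`) proved `deg Z(t)_ℚ = δ(d; 6)·H(4t)` when the conductor `F` of `ℤ[√−t]`
(`−4t = F²d`) is coprime to `6`, i.e. `t ≡ 1, 2 (mod 4)` and `9 ∤ t`, and left the residual class `t ≡ 3 (mod 4)`
(`2 ∥ F`) open. There `ℤ[√−t] ⊂ ℤ[(1 + √−t)/2]` has index `2`, the conductor set of the trace-`1` pair
`(1, (t+1)/4)` (discriminant `1 − 4·(t+1)/4 = −t`) is the conductor set of `(0, t)` halved, and KRY's sum over the
conductors `c` coprime to `6` of `−4t` is the FULL conductor sum of `−t`: **`deg Z(t)_ℚ = δ(d; 6)·H(t)`** for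
`t ≡ 3 (mod 4)`, `9 ∤ t`. With the invariances `deg Z(4t) = deg Z(9t) = deg Z(t)` (row g41-#4) every `t > 0` is thus
reduced to a Hurwitz class number: for `4 ∤ t`, `9 ∤ t`, `deg Z(t)_ℚ = δ(d; 6)·H(t*)`, `t* = t` if `t ≡ 3 (mod 4)` and
`t* = 4t` otherwise (`kry_degree_formula_hurwitz_reduced`). Notation as in the sibling files (`t` is `m` in the
code, `F = conductor 0 t`, `d = t_F² − 4n_F`, `δ(d; 6) = (1 − χ₈(d))(1 − (d∕3))`, `H = hurwitzClassNumber`,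
`deg Z(t)_ℚ = 2·Σᶠ_{[x] ∈ L(t)/O₆^×} e_x⁻¹`).

## The print

* S. Kudla, M. Rapoport, T. Yang, *Modular Forms and Special Cycles on Shimura Curves* (2006): p. vi (held p0006)
  «`deg Z(t) = H(4t)`, where `H(n)` is the Hurwitz class number» (modular curve); §3.4 p. 45 (held p0053)
  (3.4.4)–(3.4.6), (3.4.14), `4t = n²d`. [cite: KudlaRapoportYang2006, p. vi and §3.4 (3.4.4)–(3.4.6), (3.4.14)]
* H. Cohen, *A Course in Computational Algebraic Number Theory* (1993), §5.3.2 Def. 5.3.6 / Lemma 5.3.7 (p. 234,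
  held p0285–p0286) and Appendix B Table B.1 `(d, h(d), H(−d))` (held p0573). [cite: Cohen1993, §5.3.2 Lemma 5.3.7, p. 234 and Appendix B Table B.1]
* D. A. Cox, *Primes of the form x² + ny²*, 2nd ed. (2013), §7.A (7.2)–(7.3) and Lemma 7.2 (the orders
  `ℤ[√−n] ⊂ ℤ[(1+√−n)/2]` for `n ≡ 3 (mod 4)`). [cite: Cox2013, §7.A (7.2)–(7.3) and Lemma 7.2]

## What is proved (every `t > 0` with `t ≡ 3 (mod 4)` unless said otherwise)

* §1 `four_mul_succ_div_four` (`4·((t+1)/4) = t + 1`); **`conductor_zero_eq_two_mul_conductor_one`**: the conductor of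
  `(0, t)` is twice the conductor `F₁` of `(1, (t+1)/4)` and the two fundamental discriminants coincide
  (`t_F² − 4n_F` for both pairs); `conductor_one_coprime_six` (`9 ∤ t ⟹ (F₁, 6) = 1`);
  `divisors_filter_coprime_six_two_mul` (the divisors of `2F₁` coprime to `6` are the divisors of `F₁` when
  `(F₁, 6) = 1`).
* §2 **`kry_degree_formula_hurwitz_of_mod_four_eq_three`**: `t ≡ 3 (mod 4)`, `9 ∤ t ⟹ deg Z(t)_ℚ = δ(d; 6)·H(t)`;
  **`kry_degree_formula_hurwitz_reduced`**: `4 ∤ t`, `9 ∤ t ⟹ deg Z(t)_ℚ = δ(d; 6)·H(t*)` with `t* = t` or `4t`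
  according as `t ≡ 3 (mod 4)` or not — together with `degree_four_mul`/`degree_nine_mul` this evaluates
  `deg Z(t)_ℚ` for every `t` from a class-number table.
* §3 new values: `hurwitzClassNumber_sixtyseven` (`H(67) = 1`), `hurwitzClassNumber_ninetyone` (`H(91) = 2`),
  `hurwitzClassNumber_hundredsixtythree` (`H(163) = 1`); **`degree_sixtyseven`** (`deg Z(67)_ℚ = 4`),
  **`degree_ninetyone`** (`deg Z(91)_ℚ = 8`), **`degree_hundredsixtythree`** (`deg Z(163)_ℚ = 4·H(163) = 4`).

## Scope (honest)

Only `D(B) = 6`; the cases `4 ∣ t` or `9 ∣ t` are covered only through the invariances of row g41-#4, not restated.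
-/

set_option maxSynthPendingDepth 3

open Quaternion Function
open scoped Pointwise
open Literature.NumberTheory.Automorphic Literature.NumberTheory.Automorphic.Brandt
open Literature.NumberTheory.Automorphic.HeckeTraceFormulaGL2Level (ellipticConductors weightedClassNumber)
open Literature.NumberTheory.QuadraticFields.Quadratic (BinQF.classNumber)
open Literature.NumberTheory.QuadraticFields (hurwitzClassNumber hurwitzClassNumber_eq_sum_sq_mul_disc
  hurwitzClassNumber_eq_sum_ellipticConductors)

namespace Literature.Geometry.Kaehler.ComplexTorus.QuaternionType

/-! ## §1 `t ≡ 3 (mod 4)`: the conductor of `(0, t)` is twice that of `(1, (t+1)/4)`, same fundamental discriminant -/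

section ThreeModFour

/-- `4·((t + 1)/4) = t + 1` for `t ≡ 3 (mod 4)`. [folklore] [cite: Cox2013, §7.A Lemma 7.2] -/
theorem four_mul_succ_div_four {m : ℕ} (h3 : m % 4 = 3) : 4 * ((m + 1) / 4) = m + 1 := by
  omega

/-- **For `t ≡ 3 (mod 4)` the conductor of `ℤ[√−t]` is twice the conductor of `ℤ[(1 + √−t)/2]`, with the same
fundamental discriminant**: `conductor 0 t = 2·conductor 1 ((t+1)/4)` and `t_F² − 4n_F` agree for the two pairs
(`−4t = (2F₁)²d`, `−t = F₁²d`). Proof: `g ↦ 2g` maps the conductor set of `(1, (t+1)/4)` into that of `(0, t)`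
(`−4t/(2g)² = −t/g²`), and the even conductor `F = 2g` of `(0, t)` (`two_dvd_conductor_iff`) has `g` in the former.
[cite: Cox2013, §7.A (7.2)–(7.3) and Lemma 7.2] [cite: KudlaRapoportYang2006, §3.4 («`4t = n²d`»)] -/
theorem conductor_zero_eq_two_mul_conductor_one {m : ℕ} (hm : 0 < m) (h3 : m % 4 = 3) :
    conductor 0 m = 2 * conductor 1 ((m + 1) / 4) ∧
      (tOf 0 m (conductor 0 m) ^ 2 - 4 * nOf 0 m (conductor 0 m)) = tOf 1 ((m + 1) / 4) (conductor 1 ((m + 1) / 4)) ^ 2 - 4 * nOf 1 ((m + 1) / 4) (conductor 1 ((m + 1) / 4)) := by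
  have h4 : 4 * ((m + 1) / 4) = m + 1 := four_mul_succ_div_four h3
  set n₀ := (m + 1) / 4 with hn₀
  have hn₀Z : (4 : ℤ) * n₀ = m + 1 := by exact_mod_cast h4
  have hlt : (0 : ℤ) ^ 2 < 4 * m := by positivity
  have hmZ : (0 : ℤ) < m := by exact_mod_cast hm
  have hlt₁ : (1 : ℤ) ^ 2 < 4 * n₀ := by rw [hn₀Z]; linarith
  have hΔ₁ : (1 : ℤ) ^ 2 - 4 * n₀ = -m := by rw [hn₀Z]; ring
  -- (a) `g ∈ E₁ ⟹ 2g ∈ E₀`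
  have up : ∀ {g : ℕ}, g ∈ ellipticConductors 1 n₀ → 2 * g ∈ ellipticConductors 0 m := by
    intro g hg
    rw [mem_ellipticConductors_iff hlt₁] at hg
    obtain ⟨hg0, ⟨e, he⟩, hmod⟩ := hg
    rw [hΔ₁] at he
    have hgZ : ((g : ℤ)) ^ 2 ≠ 0 := pow_ne_zero 2 (by exact_mod_cast hg0.ne')
    have hq₁ : ((1 : ℤ) ^ 2 - 4 * n₀) / (g : ℤ) ^ 2 = e := by rw [hΔ₁, he, Int.mul_ediv_cancel_left _ hgZ]
    rw [hq₁] at hmod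
    rw [mem_ellipticConductors_iff hlt]
    have h2gZ : (((2 * g : ℕ) : ℤ)) ^ 2 ≠ 0 := pow_ne_zero 2 (by positivity)
    have e' : (0 : ℤ) ^ 2 - 4 * m = ((2 * g : ℕ) : ℤ) ^ 2 * e := by push_cast; linear_combination (4 : ℤ) * he
    refine ⟨by positivity, ⟨e, e'⟩, ?_⟩
    rw [e', Int.mul_ediv_cancel_left _ h2gZ]
    exact hmod
  -- (b) `F₀ = 2g` with `g ∈ E₁`
  have h2F : 2 ∣ conductor 0 m := (two_dvd_conductor_iff hm).2 (Or.inr h3)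
  obtain ⟨g, hg⟩ := h2F
  have hF0mem := conductor_mem hlt
  rw [hg, mem_ellipticConductors_iff hlt] at hF0mem
  obtain ⟨h2g0, ⟨e, he⟩, hmod⟩ := hF0mem
  have hg0 : 0 < g := by
    rcases Nat.eq_zero_or_pos g with h | h
    · rw [h, mul_zero] at h2g0; exact absurd h2g0 (lt_irrefl 0)
    · exact h
  have h2gZ : (((2 * g : ℕ) : ℤ)) ^ 2 ≠ 0 := pow_ne_zero 2 (by positivity)
  have hq₀ : ((0 : ℤ) ^ 2 - 4 * m) / ((2 * g : ℕ) : ℤ) ^ 2 = e := by rw [he, Int.mul_ediv_cancel_left _ h2gZ]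
  rw [hq₀] at hmod
  have heg : (1 : ℤ) ^ 2 - 4 * n₀ = (g : ℤ) ^ 2 * e := by
    rw [hΔ₁]
    have : (0 : ℤ) ^ 2 - 4 * m = 4 * ((g : ℤ) ^ 2 * e) := by rw [he]; push_cast; ring
    linarith
  have hgmem : g ∈ ellipticConductors 1 n₀ := by
    rw [mem_ellipticConductors_iff hlt₁]
    have hgZ : ((g : ℤ)) ^ 2 ≠ 0 := pow_ne_zero 2 (by exact_mod_cast hg0.ne')
    refine ⟨hg0, ⟨e, heg⟩, ?_⟩
    rw [heg, Int.mul_ediv_cancel_left _ hgZ]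
    exact hmod
  -- (c) `F₀ = 2F₁`
  have hF : conductor 0 m = 2 * conductor 1 n₀ := by
    apply Nat.dvd_antisymm
    · rw [hg]
      exact Nat.mul_dvd_mul_left 2 ((mem_ellipticConductors_iff_dvd hlt₁).1 hgmem)
    · exact (mem_ellipticConductors_iff_dvd hlt).1 (up (conductor_mem hlt₁))
  refine ⟨hF, ?_⟩
  -- (d) the discriminants: `(−4t)/(2F₁)² = (−t)/F₁²`
  rw [← disc_div_sq hlt (conductor_mem hlt), ← disc_div_sq hlt₁ (conductor_mem hlt₁), hF]
  have hF₁0 : ((conductor 1 n₀ : ℕ) : ℤ) ≠ 0 := by exact_mod_cast (conductor_pos hlt₁).ne'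
  obtain ⟨E, hE⟩ := ((mem_ellipticConductors_iff hlt₁).1 (conductor_mem hlt₁)).2.1
  have hE' : (0 : ℤ) ^ 2 - 4 * m = ((2 * conductor 1 n₀ : ℕ) : ℤ) ^ 2 * E := by
    push_cast; linear_combination (4 : ℤ) * hE - 4 * hΔ₁
  rw [hE', hE, Int.mul_ediv_cancel_left _ (pow_ne_zero 2 hF₁0),
    Int.mul_ediv_cancel_left _ (pow_ne_zero 2 (by push_cast; positivity))]

/-- For `t ≡ 3 (mod 4)` with `9 ∤ t`, the conductor `F₁ = F/2` of `ℤ[(1 + √−t)/2]` is coprime to `6` (`F₁` is odd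
since `4 ∤ F²d = −4t`, and `3 ∣ F₁ ⟹ 9 ∣ t`). [cite: Cox2013, §7.A (7.2)–(7.3) and Lemma 7.2] -/
theorem conductor_one_coprime_six {m : ℕ} (hm : 0 < m) (h3 : m % 4 = 3) (h9 : ¬ 9 ∣ m) :
    (conductor 1 ((m + 1) / 4)).Coprime 6 := by
  obtain ⟨hF, -⟩ := conductor_zero_eq_two_mul_conductor_one hm h3
  set F₁ := conductor 1 ((m + 1) / 4) with hF₁
  have hFD := conductor_sq_mul_disc hm
  have hD4 := disc_conductor_emod_four hm
  -- `F₁` odd: otherwise `16 ∣ F² ∣ … ` forces `4 ∣ t`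
  have h2 : ¬ 2 ∣ F₁ := by
    rintro ⟨k, hk⟩
    have hF' : ((conductor 0 m : ℕ) : ℤ) = 4 * k := by rw [hF, hk]; push_cast; ring
    rw [hF'] at hFD
    -- `16k²D = −4m`, so `4 ∣ m`
    have h16 : (4 : ℤ) * m = 4 * (-4 * (k ^ 2 * (tOf 0 m (conductor 0 m) ^ 2 - 4 * nOf 0 m (conductor 0 m)))) := by linear_combination hFD
    have h4m : (m : ℤ) = -4 * (k ^ 2 * (tOf 0 m (conductor 0 m) ^ 2 - 4 * nOf 0 m (conductor 0 m))) := Int.eq_of_mul_eq_mul_left (by norm_num) h16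
    generalize k ^ 2 * (tOf 0 m (conductor 0 m) ^ 2 - 4 * nOf 0 m (conductor 0 m)) = K at h4m
    omega
  have h3' : ¬ 3 ∣ F₁ := by
    intro hd
    have : 3 ∣ conductor 0 m := by rw [hF]; exact Dvd.dvd.mul_left hd 2
    exact h9 (by simpa using (prime_dvd_conductor_iff hm Nat.prime_three (by norm_num)).1 this)
  rw [show (6 : ℕ) = 2 * 3 by norm_num, Nat.coprime_mul_iff_right,
    Nat.coprime_comm (n := F₁), Nat.prime_two.coprime_iff_not_dvd,
    Nat.coprime_comm (n := F₁), Nat.prime_three.coprime_iff_not_dvd]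
  exact ⟨h2, h3'⟩

/-- The divisors of `2F₁` coprime to `6` are the divisors of `F₁`, when `(F₁, 6) = 1`. [folklore]
[cite: KudlaRapoportYang2006, §3.4 (3.4.6) (the condition `(c, D) = 1`)] -/
theorem divisors_filter_coprime_six_two_mul {F₁ : ℕ} (h6 : F₁.Coprime 6) (hF₁ : F₁ ≠ 0) :
    ((2 * F₁).divisors.filter fun c : ℕ => c.Coprime 6) = F₁.divisors := by
  ext c
  simp only [Finset.mem_filter, Nat.mem_divisors]
  constructor
  · rintro ⟨⟨hc, -⟩, hc6⟩
    have hc2 : c.Coprime 2 := Nat.Coprime.coprime_dvd_right (by norm_num : 2 ∣ 6) hc6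
    exact ⟨hc2.dvd_of_dvd_mul_left hc, hF₁⟩
  · rintro ⟨hc, -⟩
    exact ⟨⟨Dvd.dvd.mul_left hc 2, by positivity⟩, Nat.Coprime.coprime_dvd_left hc h6⟩

end ThreeModFour

/-! ## §2 `deg Z(t)_ℚ = δ(d; 6)·H(t)` for `t ≡ 3 (mod 4)`, `9 ∤ t`; the reduction of every `t` -/

section Hurwitz

/-- **`deg Z(t)_ℚ = δ(d; 6)·H(t)` FOR `t ≡ 3 (mod 4)`, `9 ∤ t`**: KRY's conductors `c ∣ F = 2F₁` coprime to `6` are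
all the conductors `c ∣ F₁` of `−t = F₁²d`, so `Σ_{c∣F,(c,6)=1} h_w(c²d) = Σ_{c∣F₁} h_w(c²d) = H(t)` (row g42-#1 at
trace `1`). [cite: KudlaRapoportYang2006, p. vi and §3.4 (3.4.4)–(3.4.6), (3.4.14)] [cite: Cohen1993, §5.3.2 Lemma 5.3.7 (1), p. 234] -/
theorem kry_degree_formula_hurwitz_of_mod_four_eq_three {m : ℕ} (hm : 0 < m) (h3 : m % 4 = 3) (h9 : ¬ 9 ∣ m) :
    2 * ∑ᶠ q : (Quot (fun x y : {x : ℤ × ℤ × ℤ // x.1 ^ 2 - 3 * x.2.1 ^ 2 - 3 * x.2.2 ^ 2 = (m : ℤ)} ↦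
      ∃ v : ℍ[ℚ,((-1 : ℤ) : ℚ),((3 : ℤ) : ℚ)], (v ∈ order (-1) 3 ∨ v - ⟨1/2, 1/2, 1/2, -1/2⟩ ∈ order (-1) 3) ∧
        ((v * star v).re = 1 ∨ (v * star v).re = -1) ∧
        v * ⟨0, x.1.1, x.1.2.1, x.1.2.2⟩ = ⟨0, y.1.1, y.1.2.1, y.1.2.2⟩ * v)),
        ((Nat.card
          {u : ℍ[ℚ,((-1 : ℤ) : ℚ),((3 : ℤ) : ℚ)] // (u ∈ order (-1) 3 ∨ u - ⟨1/2, 1/2, 1/2, -1/2⟩ ∈ order (-1) 3) ∧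
            ((u * star u).re = 1 ∨ (u * star u).re = -1) ∧
            u * ⟨0, q.out.1.1, q.out.1.2.1, q.out.1.2.2⟩ = ⟨0, q.out.1.1, q.out.1.2.1, q.out.1.2.2⟩ * u} : ℚ))⁻¹ = ((((1 - ZMod.χ₈ ((((tOf 0 m (conductor 0 m) ^ 2 - 4 * nOf 0 m (conductor 0 m)) : ℤ)) : ZMod 8)) * (1 - legendreSym 3 (tOf 0 m (conductor 0 m) ^ 2 - 4 * nOf 0 m (conductor 0 m)))) : ℤ) : ℚ) * hurwitzClassNumber m := by
  obtain ⟨hF, hd⟩ := conductor_zero_eq_two_mul_conductor_one hm h3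
  have h6 := conductor_one_coprime_six hm h3 h9
  have h4 : 4 * ((m + 1) / 4) = m + 1 := four_mul_succ_div_four h3
  have hmZ : (0 : ℤ) < m := by exact_mod_cast hm
  have hlt₁ : (1 : ℤ) ^ 2 < 4 * (((m + 1) / 4 : ℕ) : ℤ) := by
    have : (4 : ℤ) * (((m + 1) / 4 : ℕ) : ℤ) = m + 1 := by exact_mod_cast h4
    rw [this]; linarith
  have hS : ((conductor 0 m).divisors.filter fun c : ℕ => c.Coprime 6) = (conductor 1 ((m + 1) / 4)).divisors := by
    rw [hF]; exact divisors_filter_coprime_six_two_mul h6 (conductor_pos hlt₁).ne'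
  have hm' : (m : ℤ) = 4 * (((m + 1) / 4 : ℕ) : ℤ) - (1 : ℤ) ^ 2 := by
    have : (4 : ℤ) * (((m + 1) / 4 : ℕ) : ℤ) = m + 1 := by exact_mod_cast h4
    linarith
  have hH : hurwitzClassNumber (m : ℤ) =
      ∑ c ∈ (conductor 1 ((m + 1) / 4)).divisors, weightedClassNumber ((c : ℤ) ^ 2 *
        (tOf 1 ((m + 1) / 4) (conductor 1 ((m + 1) / 4)) ^ 2 - 4 * nOf 1 ((m + 1) / 4) (conductor 1 ((m + 1) / 4)))) := by
    rw [hm']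
    exact hurwitzClassNumber_eq_sum_sq_mul_disc hlt₁
  rw [kry_degree_formula_weighted hm, hS, hH, ← hd]

/-- **EVERY `t` REDUCES TO A HURWITZ CLASS NUMBER**: for `4 ∤ t` and `9 ∤ t`,
`deg Z(t)_ℚ = δ(d; 6)·H(t*)` with `t* = t` if `t ≡ 3 (mod 4)` and `t* = 4t` if `t ≡ 1, 2 (mod 4)`; the remaining
`t` are handled by `deg Z(4t)_ℚ = deg Z(t)_ℚ`, `deg Z(9t)_ℚ = deg Z(t)_ℚ` (`degree_four_mul`, `degree_nine_mul`).
[cite: KudlaRapoportYang2006, p. vi and §3.4 (3.4.4)–(3.4.6), (3.4.14)] [cite: Cohen1993, §5.3.2 Lemma 5.3.7 (1), p. 234] -/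
theorem kry_degree_formula_hurwitz_reduced {m : ℕ} (hm : 0 < m) (h4 : ¬ 4 ∣ m) (h9 : ¬ 9 ∣ m) :
    2 * ∑ᶠ q : (Quot (fun x y : {x : ℤ × ℤ × ℤ // x.1 ^ 2 - 3 * x.2.1 ^ 2 - 3 * x.2.2 ^ 2 = (m : ℤ)} ↦
      ∃ v : ℍ[ℚ,((-1 : ℤ) : ℚ),((3 : ℤ) : ℚ)], (v ∈ order (-1) 3 ∨ v - ⟨1/2, 1/2, 1/2, -1/2⟩ ∈ order (-1) 3) ∧
        ((v * star v).re = 1 ∨ (v * star v).re = -1) ∧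
        v * ⟨0, x.1.1, x.1.2.1, x.1.2.2⟩ = ⟨0, y.1.1, y.1.2.1, y.1.2.2⟩ * v)),
        ((Nat.card
          {u : ℍ[ℚ,((-1 : ℤ) : ℚ),((3 : ℤ) : ℚ)] // (u ∈ order (-1) 3 ∨ u - ⟨1/2, 1/2, 1/2, -1/2⟩ ∈ order (-1) 3) ∧
            ((u * star u).re = 1 ∨ (u * star u).re = -1) ∧
            u * ⟨0, q.out.1.1, q.out.1.2.1, q.out.1.2.2⟩ = ⟨0, q.out.1.1, q.out.1.2.1, q.out.1.2.2⟩ * u} : ℚ))⁻¹ = ((((1 - ZMod.χ₈ ((((tOf 0 m (conductor 0 m) ^ 2 - 4 * nOf 0 m (conductor 0 m)) : ℤ)) : ZMod 8)) * (1 - legendreSym 3 (tOf 0 m (conductor 0 m) ^ 2 - 4 * nOf 0 m (conductor 0 m)))) : ℤ) : ℚ) * hurwitzClassNumber (if m % 4 = 3 then (m : ℤ) else 4 * m) := by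
  by_cases h3 : m % 4 = 3
  · rw [if_pos h3]; exact kry_degree_formula_hurwitz_of_mod_four_eq_three hm h3 h9
  · rw [if_neg h3]; exact kry_degree_formula_hurwitz_of_mod_four hm (by omega) h9

end Hurwitz

/-! ## §3 New values: `deg Z(67)_ℚ = 4`, `deg Z(91)_ℚ = 8`, `deg Z(163)_ℚ = 4` -/

section Values

/-- `H(67) = 1 = h(−67)` (Cohen's Table B.1 row `(−67, 1, 1)`). [cite: Cohen1993, §5.3.2 Def. 5.3.6 p. 234 and Appendix B Table B.1 (d, h(d), H(−d))] -/
theorem hurwitzClassNumber_sixtyseven : hurwitzClassNumber 67 = 1 := by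
  rw [show (67 : ℤ) = 4 * ((17 : ℕ) : ℤ) - (1 : ℤ) ^ 2 by norm_num,
    hurwitzClassNumber_eq_sum_ellipticConductors (by norm_num)]
  decide +kernel

/-- `H(91) = 2 = h(−91)` (Cohen's Table B.1 row `(−91, 2, 2)`). [cite: Cohen1993, §5.3.2 Def. 5.3.6 p. 234 and Appendix B Table B.1 (d, h(d), H(−d))] -/
theorem hurwitzClassNumber_ninetyone : hurwitzClassNumber 91 = 2 := by
  rw [show (91 : ℤ) = 4 * ((23 : ℕ) : ℤ) - (1 : ℤ) ^ 2 by norm_num,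
    hurwitzClassNumber_eq_sum_ellipticConductors (by norm_num)]
  decide +kernel

/-- `H(163) = 1 = h(−163)` (Cohen's Table B.1 row `(−163, 1, 1)`; the last class-number-one discriminant).
[cite: Cohen1993, §5.3.2 Def. 5.3.6 p. 234 and Appendix B Table B.1 (d, h(d), H(−d))] -/
theorem hurwitzClassNumber_hundredsixtythree : hurwitzClassNumber 163 = 1 := by
  rw [show (163 : ℤ) = 4 * ((41 : ℕ) : ℤ) - (1 : ℤ) ^ 2 by norm_num,
    hurwitzClassNumber_eq_sum_ellipticConductors (by norm_num)]
  decide +kernel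

/-- **`deg Z(67)_ℚ = 4`** (new row; `67 ≡ 3 (mod 4)`): `d = −67`, `χ₈(−67) = −1`, `(−67∕3) = −1`, `δ = 4`,
`H(67) = 1`. [cite: KudlaRapoportYang2006, §3.4 (3.4.4)–(3.4.6) and (3.4.14)] [cite: Cohen1993, Appendix B Table B.1 (d, h(d), H(−d))] -/
theorem degree_sixtyseven : 2 * ∑ᶠ q : (Quot (fun x y : {x : ℤ × ℤ × ℤ // x.1 ^ 2 - 3 * x.2.1 ^ 2 - 3 * x.2.2 ^ 2 = (67 : ℤ)} ↦
      ∃ v : ℍ[ℚ,((-1 : ℤ) : ℚ),((3 : ℤ) : ℚ)], (v ∈ order (-1) 3 ∨ v - ⟨1/2, 1/2, 1/2, -1/2⟩ ∈ order (-1) 3) ∧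
        ((v * star v).re = 1 ∨ (v * star v).re = -1) ∧
        v * ⟨0, x.1.1, x.1.2.1, x.1.2.2⟩ = ⟨0, y.1.1, y.1.2.1, y.1.2.2⟩ * v)),
        ((Nat.card
          {u : ℍ[ℚ,((-1 : ℤ) : ℚ),((3 : ℤ) : ℚ)] // (u ∈ order (-1) 3 ∨ u - ⟨1/2, 1/2, 1/2, -1/2⟩ ∈ order (-1) 3) ∧
            ((u * star u).re = 1 ∨ (u * star u).re = -1) ∧
            u * ⟨0, q.out.1.1, q.out.1.2.1, q.out.1.2.2⟩ = ⟨0, q.out.1.1, q.out.1.2.1, q.out.1.2.2⟩ * u} : ℚ))⁻¹ = 4 := by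
  have e : 2 * ∑ᶠ q : (Quot (fun x y : {x : ℤ × ℤ × ℤ // x.1 ^ 2 - 3 * x.2.1 ^ 2 - 3 * x.2.2 ^ 2 = (67 : ℤ)} ↦
      ∃ v : ℍ[ℚ,((-1 : ℤ) : ℚ),((3 : ℤ) : ℚ)], (v ∈ order (-1) 3 ∨ v - ⟨1/2, 1/2, 1/2, -1/2⟩ ∈ order (-1) 3) ∧
        ((v * star v).re = 1 ∨ (v * star v).re = -1) ∧
        v * ⟨0, x.1.1, x.1.2.1, x.1.2.2⟩ = ⟨0, y.1.1, y.1.2.1, y.1.2.2⟩ * v)),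
        ((Nat.card
          {u : ℍ[ℚ,((-1 : ℤ) : ℚ),((3 : ℤ) : ℚ)] // (u ∈ order (-1) 3 ∨ u - ⟨1/2, 1/2, 1/2, -1/2⟩ ∈ order (-1) 3) ∧
            ((u * star u).re = 1 ∨ (u * star u).re = -1) ∧
            u * ⟨0, q.out.1.1, q.out.1.2.1, q.out.1.2.2⟩ = ⟨0, q.out.1.1, q.out.1.2.1, q.out.1.2.2⟩ * u} : ℚ))⁻¹ = 2 * ∑ᶠ q : (Quot (fun x y : {x : ℤ × ℤ × ℤ // x.1 ^ 2 - 3 * x.2.1 ^ 2 - 3 * x.2.2 ^ 2 = ((67 : ℕ) : ℤ)} ↦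
      ∃ v : ℍ[ℚ,((-1 : ℤ) : ℚ),((3 : ℤ) : ℚ)], (v ∈ order (-1) 3 ∨ v - ⟨1/2, 1/2, 1/2, -1/2⟩ ∈ order (-1) 3) ∧
        ((v * star v).re = 1 ∨ (v * star v).re = -1) ∧
        v * ⟨0, x.1.1, x.1.2.1, x.1.2.2⟩ = ⟨0, y.1.1, y.1.2.1, y.1.2.2⟩ * v)),
        ((Nat.card
          {u : ℍ[ℚ,((-1 : ℤ) : ℚ),((3 : ℤ) : ℚ)] // (u ∈ order (-1) 3 ∨ u - ⟨1/2, 1/2, 1/2, -1/2⟩ ∈ order (-1) 3) ∧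
            ((u * star u).re = 1 ∨ (u * star u).re = -1) ∧
            u * ⟨0, q.out.1.1, q.out.1.2.1, q.out.1.2.2⟩ = ⟨0, q.out.1.1, q.out.1.2.1, q.out.1.2.2⟩ * u} : ℚ))⁻¹ := rfl
  rw [e, kry_degree_formula_hurwitz_of_mod_four_eq_three (by norm_num : 0 < 67) (by norm_num) (by norm_num),
    disc_conductor_eq_div (by norm_num : 0 < 67), show (((67 : ℕ) : ℤ)) = 67 by norm_num,
    hurwitzClassNumber_sixtyseven]
  decide +kernel

/-- **`deg Z(91)_ℚ = 8`** (new row; `91 = 7·13 ≡ 3 (mod 4)`): `d = −91`, `χ₈(−91) = −1`, `(−91∕3) = −1`, `δ = 4`,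
`H(91) = h(−91) = 2`. [cite: KudlaRapoportYang2006, §3.4 (3.4.4)–(3.4.6) and (3.4.14)] [cite: Cohen1993, Appendix B Table B.1 (d, h(d), H(−d))] -/
theorem degree_ninetyone : 2 * ∑ᶠ q : (Quot (fun x y : {x : ℤ × ℤ × ℤ // x.1 ^ 2 - 3 * x.2.1 ^ 2 - 3 * x.2.2 ^ 2 = (91 : ℤ)} ↦
      ∃ v : ℍ[ℚ,((-1 : ℤ) : ℚ),((3 : ℤ) : ℚ)], (v ∈ order (-1) 3 ∨ v - ⟨1/2, 1/2, 1/2, -1/2⟩ ∈ order (-1) 3) ∧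
        ((v * star v).re = 1 ∨ (v * star v).re = -1) ∧
        v * ⟨0, x.1.1, x.1.2.1, x.1.2.2⟩ = ⟨0, y.1.1, y.1.2.1, y.1.2.2⟩ * v)),
        ((Nat.card
          {u : ℍ[ℚ,((-1 : ℤ) : ℚ),((3 : ℤ) : ℚ)] // (u ∈ order (-1) 3 ∨ u - ⟨1/2, 1/2, 1/2, -1/2⟩ ∈ order (-1) 3) ∧
            ((u * star u).re = 1 ∨ (u * star u).re = -1) ∧
            u * ⟨0, q.out.1.1, q.out.1.2.1, q.out.1.2.2⟩ = ⟨0, q.out.1.1, q.out.1.2.1, q.out.1.2.2⟩ * u} : ℚ))⁻¹ = 8 := by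
  have e : 2 * ∑ᶠ q : (Quot (fun x y : {x : ℤ × ℤ × ℤ // x.1 ^ 2 - 3 * x.2.1 ^ 2 - 3 * x.2.2 ^ 2 = (91 : ℤ)} ↦
      ∃ v : ℍ[ℚ,((-1 : ℤ) : ℚ),((3 : ℤ) : ℚ)], (v ∈ order (-1) 3 ∨ v - ⟨1/2, 1/2, 1/2, -1/2⟩ ∈ order (-1) 3) ∧
        ((v * star v).re = 1 ∨ (v * star v).re = -1) ∧
        v * ⟨0, x.1.1, x.1.2.1, x.1.2.2⟩ = ⟨0, y.1.1, y.1.2.1, y.1.2.2⟩ * v)),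
        ((Nat.card
          {u : ℍ[ℚ,((-1 : ℤ) : ℚ),((3 : ℤ) : ℚ)] // (u ∈ order (-1) 3 ∨ u - ⟨1/2, 1/2, 1/2, -1/2⟩ ∈ order (-1) 3) ∧
            ((u * star u).re = 1 ∨ (u * star u).re = -1) ∧
            u * ⟨0, q.out.1.1, q.out.1.2.1, q.out.1.2.2⟩ = ⟨0, q.out.1.1, q.out.1.2.1, q.out.1.2.2⟩ * u} : ℚ))⁻¹ = 2 * ∑ᶠ q : (Quot (fun x y : {x : ℤ × ℤ × ℤ // x.1 ^ 2 - 3 * x.2.1 ^ 2 - 3 * x.2.2 ^ 2 = ((91 : ℕ) : ℤ)} ↦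
      ∃ v : ℍ[ℚ,((-1 : ℤ) : ℚ),((3 : ℤ) : ℚ)], (v ∈ order (-1) 3 ∨ v - ⟨1/2, 1/2, 1/2, -1/2⟩ ∈ order (-1) 3) ∧
        ((v * star v).re = 1 ∨ (v * star v).re = -1) ∧
        v * ⟨0, x.1.1, x.1.2.1, x.1.2.2⟩ = ⟨0, y.1.1, y.1.2.1, y.1.2.2⟩ * v)),
        ((Nat.card
          {u : ℍ[ℚ,((-1 : ℤ) : ℚ),((3 : ℤ) : ℚ)] // (u ∈ order (-1) 3 ∨ u - ⟨1/2, 1/2, 1/2, -1/2⟩ ∈ order (-1) 3) ∧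
            ((u * star u).re = 1 ∨ (u * star u).re = -1) ∧
            u * ⟨0, q.out.1.1, q.out.1.2.1, q.out.1.2.2⟩ = ⟨0, q.out.1.1, q.out.1.2.1, q.out.1.2.2⟩ * u} : ℚ))⁻¹ := rfl
  rw [e, kry_degree_formula_hurwitz_of_mod_four_eq_three (by norm_num : 0 < 91) (by norm_num) (by norm_num),
    disc_conductor_eq_div (by norm_num : 0 < 91), show (((91 : ℕ) : ℤ)) = 91 by norm_num,
    hurwitzClassNumber_ninetyone]
  decide +kernel

/-- **`deg Z(163)_ℚ = 4`** (new row; `163 ≡ 3 (mod 4)`): `d = −163`, `χ₈(−163) = −1`, `(−163∕3) = −1`, `δ = 4`,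
`H(163) = h(−163) = 1` — four CM points on `X₆` with complex multiplication by `ℤ[√−163]`, each of weight `1`
(`deg = 2·Σ e⁻¹`). [cite: KudlaRapoportYang2006, §3.4 (3.4.4)–(3.4.6) and (3.4.14)] [cite: Cohen1993, Appendix B Table B.1 (d, h(d), H(−d))] -/
theorem degree_hundredsixtythree : 2 * ∑ᶠ q : (Quot (fun x y : {x : ℤ × ℤ × ℤ // x.1 ^ 2 - 3 * x.2.1 ^ 2 - 3 * x.2.2 ^ 2 = (163 : ℤ)} ↦
      ∃ v : ℍ[ℚ,((-1 : ℤ) : ℚ),((3 : ℤ) : ℚ)], (v ∈ order (-1) 3 ∨ v - ⟨1/2, 1/2, 1/2, -1/2⟩ ∈ order (-1) 3) ∧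
        ((v * star v).re = 1 ∨ (v * star v).re = -1) ∧
        v * ⟨0, x.1.1, x.1.2.1, x.1.2.2⟩ = ⟨0, y.1.1, y.1.2.1, y.1.2.2⟩ * v)),
        ((Nat.card
          {u : ℍ[ℚ,((-1 : ℤ) : ℚ),((3 : ℤ) : ℚ)] // (u ∈ order (-1) 3 ∨ u - ⟨1/2, 1/2, 1/2, -1/2⟩ ∈ order (-1) 3) ∧
            ((u * star u).re = 1 ∨ (u * star u).re = -1) ∧
            u * ⟨0, q.out.1.1, q.out.1.2.1, q.out.1.2.2⟩ = ⟨0, q.out.1.1, q.out.1.2.1, q.out.1.2.2⟩ * u} : ℚ))⁻¹ = 4 := by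
  have e : 2 * ∑ᶠ q : (Quot (fun x y : {x : ℤ × ℤ × ℤ // x.1 ^ 2 - 3 * x.2.1 ^ 2 - 3 * x.2.2 ^ 2 = (163 : ℤ)} ↦
      ∃ v : ℍ[ℚ,((-1 : ℤ) : ℚ),((3 : ℤ) : ℚ)], (v ∈ order (-1) 3 ∨ v - ⟨1/2, 1/2, 1/2, -1/2⟩ ∈ order (-1) 3) ∧
        ((v * star v).re = 1 ∨ (v * star v).re = -1) ∧
        v * ⟨0, x.1.1, x.1.2.1, x.1.2.2⟩ = ⟨0, y.1.1, y.1.2.1, y.1.2.2⟩ * v)),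
        ((Nat.card
          {u : ℍ[ℚ,((-1 : ℤ) : ℚ),((3 : ℤ) : ℚ)] // (u ∈ order (-1) 3 ∨ u - ⟨1/2, 1/2, 1/2, -1/2⟩ ∈ order (-1) 3) ∧
            ((u * star u).re = 1 ∨ (u * star u).re = -1) ∧
            u * ⟨0, q.out.1.1, q.out.1.2.1, q.out.1.2.2⟩ = ⟨0, q.out.1.1, q.out.1.2.1, q.out.1.2.2⟩ * u} : ℚ))⁻¹ = 2 * ∑ᶠ q : (Quot (fun x y : {x : ℤ × ℤ × ℤ // x.1 ^ 2 - 3 * x.2.1 ^ 2 - 3 * x.2.2 ^ 2 = ((163 : ℕ) : ℤ)} ↦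
      ∃ v : ℍ[ℚ,((-1 : ℤ) : ℚ),((3 : ℤ) : ℚ)], (v ∈ order (-1) 3 ∨ v - ⟨1/2, 1/2, 1/2, -1/2⟩ ∈ order (-1) 3) ∧
        ((v * star v).re = 1 ∨ (v * star v).re = -1) ∧
        v * ⟨0, x.1.1, x.1.2.1, x.1.2.2⟩ = ⟨0, y.1.1, y.1.2.1, y.1.2.2⟩ * v)),
        ((Nat.card
          {u : ℍ[ℚ,((-1 : ℤ) : ℚ),((3 : ℤ) : ℚ)] // (u ∈ order (-1) 3 ∨ u - ⟨1/2, 1/2, 1/2, -1/2⟩ ∈ order (-1) 3) ∧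
            ((u * star u).re = 1 ∨ (u * star u).re = -1) ∧
            u * ⟨0, q.out.1.1, q.out.1.2.1, q.out.1.2.2⟩ = ⟨0, q.out.1.1, q.out.1.2.1, q.out.1.2.2⟩ * u} : ℚ))⁻¹ := rfl
  rw [e, kry_degree_formula_hurwitz_of_mod_four_eq_three (by norm_num : 0 < 163) (by norm_num) (by norm_num),
    disc_conductor_eq_div (by norm_num : 0 < 163), show (((163 : ℕ) : ℤ)) = 163 by norm_num,
    hurwitzClassNumber_hundredsixtythree]
  decide +kernel

end Values

end Literature.Geometry.Kaehler.ComplexTorus.QuaternionType
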